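import Summits.PneNP.PneNP.Theorems.ConvexRankGatesCliqueExtLowerBoundConvRowCone
import Summits.PneNP.PneNP.Theorems.ConvexRankGatesCliqueExtLowerBoundStubNarrowAlgebraic

/-!
# Degree-profile CONV gates satisfy the leaf `stub_convWideCnf`
(crux `CliqueExtLowerBound`, stmt-PneNP-10682; line `width-threshold-certificate-sparsity`)

A structural sub-class of the CONV leaf, wide and high-dimensional (any number of rows, any psd dimension, any
real `A, b`), not covered by the landed few-rows / bounded-dimension / threshold engines: SDP-feasibility gates
`∃ Y ⪰ 0, tr(Aᵢ Y) ≤ bᵢ + (B·x)ᵢ` reading the raw edge slots through a bijective wiring `w`, with switching matrix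
induced by non-negative vertex potentials plus constants, `B i j = β i + ∑ₐ Λ i a [a ∈ w j]`.

* `card_negFilter_offDegree_mul_le`, `eventually_degree_numerics` — all but `≤ m·2^m/⌊m^{1/8}⌋₊^{m/2} ≤ #N/(8m^{c+1})`
  of the referee negatives have every vertex of OFF-degree `≤ m/2` (union bound over star clauses,
  `card_filter_neg_mul_pow_le`);
* `le_card_filter_on_at`, `card_filter_cliqueVec_le`, `choose_kk_succ_le` — such a negative has all degrees
  `≥ m - 1 - m/2 ≥ C(k+1, 2) ≥` every degree and the edge number of a bare `k`-clique, `k = ⌈m^{1/4}⌉₊`;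
* `rowPotential_sum_eq`, `degreeProfile_rowDominated` — hence it dominates every positive through the rows;
* `degreeProfileGate_convWideCnf` — the conclusion of `stub_convWideCnf` for this class, every `c`, eventually in
  `m`, all `r, s` (`ConvRowCone.convWideCnf_of_rowDominated`). Stub-worker of lead seat c10, 2026-08-17. -/

set_option linter.dupNamespace false
open Literature.Computability.Complexity Filter Finset
open Summit.PneNP.PneNP.Theorems.CliqueExtLowerBound.WidthThreshold

noncomputable section

namespace Summit.PneNP.PneNP.Theorems.CliqueExtLowerBound.WidthThreshold.ConvDegreeProfile

open Summit.PneNP.PneNP.Theorems.CliqueExtLowerBound.WidthThreshold.ConvRowCone (convWideCnf_of_rowDominated)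
open Summit.PneNP.PneNP.Theorems.CliqueExtLowerBound.WidthThreshold.NarrowAlgebraicHelpers
  (card_filter_neg_mul_pow_le exists_mul_pow_le_two_pow cast_le_eps_mul lt_floor_rpow_add_one_pow
    ceil_rpow_sub_one_pow_lt le_ceil_rpow_pow)
open Summit.PneNP.PneNP.Theorems.CliqueExtLowerBound.WidthThreshold.NarrowAlgebraic
  (card_mul_le_of_subset_biUnion)

/-! ## §3 Degree-profile CONV gates: an explicit row-dominated (hence blind) sub-class -/

open Classical in
/-- A bare clique vector on `Q` has at most `C(#Q + 1, 2)` on-slots (they inject into `Q.sym2`).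
[folklore] -/
theorem card_filter_cliqueVec_le {m : ℕ} (Q : Finset (Fin m)) :
    #(univ.filter fun e : EV m => cliqueVec Q e = true) ≤ (#Q + 1).choose 2 := by
  rw [← Finset.card_sym2]
  refine card_le_card_of_injOn (fun e : EV m => (e : Sym2 (Fin m))) (fun e he => ?_)
    (fun e _ e' _ h => Subtype.ext h)
  rw [mem_coe, mem_filter] at he
  rw [mem_coe, Finset.mem_sym2_iff]
  simpa [cliqueVec] using he.2

open Classical in
/-- If fewer than `h` vertices `t ≠ a` have the slot `{a, t}` OFF in `y`, then at least `m - h`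
slots at `a` are ON in `y` (the vertex `a` has `m - 1` slots). [folklore] -/
theorem le_card_filter_on_at {m h : ℕ} (y : EV m → Bool) (a : Fin m)
    (hlt : #(univ.filter fun t : Fin m => t ≠ a ∧
      ∃ e : EV m, (e : Sym2 (Fin m)) = s(a, t) ∧ y e = false) < h) :
    m - h ≤ #(univ.filter fun e : EV m => a ∈ (e : Sym2 (Fin m)) ∧ y e = true) := by
  set T₀ := univ.filter fun t : Fin m => t ≠ a ∧
    ∃ e : EV m, (e : Sym2 (Fin m)) = s(a, t) ∧ y e = false with hT₀
  set T₁ := univ.filter fun t : Fin m => t ≠ a ∧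
    ∃ e : EV m, (e : Sym2 (Fin m)) = s(a, t) ∧ y e = true with hT₁
  have hmem : ∀ t : Fin m, t ≠ a → s(a, t) ∈ (⊤ : SimpleGraph (Fin m)).edgeSet := fun t ht => by
    rw [SimpleGraph.mem_edgeSet, SimpleGraph.top_adj]
    exact ht.symm
  have hcover : univ.erase a ⊆ T₀ ∪ T₁ := by
    intro t ht
    rw [mem_erase] at ht
    have hta : t ≠ a := ht.1
    rw [mem_union]
    cases hy : y ⟨s(a, t), hmem t hta⟩
    · exact Or.inl (mem_filter.2 ⟨mem_univ _, hta, ⟨s(a, t), hmem t hta⟩, rfl, hy⟩)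
    · exact Or.inr (mem_filter.2 ⟨mem_univ _, hta, ⟨s(a, t), hmem t hta⟩, rfl, hy⟩)
  have hcard : m - 1 ≤ #T₀ + #T₁ := by
    have h1 : #((univ : Finset (Fin m)).erase a) = m - 1 := by
      rw [card_erase_of_mem (mem_univ a), card_univ, Fintype.card_fin]
    calc m - 1 = #((univ : Finset (Fin m)).erase a) := h1.symm
      _ ≤ #(T₀ ∪ T₁) := card_le_card hcover
      _ ≤ #T₀ + #T₁ := card_union_le _ _
  have hT₁ : #T₁ ≤ #(univ.filter fun e : EV m => a ∈ (e : Sym2 (Fin m)) ∧ y e = true) := by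
    calc #T₁ ≤ #((univ.filter fun e : EV m => a ∈ (e : Sym2 (Fin m)) ∧ y e = true).image
          fun e : EV m => (e : Sym2 (Fin m))) := by
          refine card_le_card_of_injOn (fun t => s(a, t)) (fun t ht => ?_)
            (fun t _ t' _ h => Sym2.congr_right.1 h)
          rw [mem_coe, mem_filter] at ht
          obtain ⟨-, -, e, he, hye⟩ := ht
          rw [mem_coe, mem_image]
          refine ⟨e, mem_filter.2 ⟨mem_univ _, ?_, hye⟩, he⟩
          rw [he]
          exact Sym2.mem_mk_left _ _
      _ ≤ _ := card_image_le
  omega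

/-- The star clause of `(a, T)` — the slots `{a, t}`, `t ∈ T` — has at least `#T - 1` slots.
[folklore] -/
theorem le_card_starClause {m : ℕ} (a : Fin m) (T : Finset (Fin m)) :
    #T - 1 ≤ #(univ.filter fun e : EV m => ∃ t ∈ T, (e : Sym2 (Fin m)) = s(a, t)) := by
  classical
  have hmem : ∀ t : Fin m, t ≠ a → s(a, t) ∈ (⊤ : SimpleGraph (Fin m)).edgeSet := fun t ht => by
    rw [SimpleGraph.mem_edgeSet, SimpleGraph.top_adj]
    exact ht.symm
  calc #T - 1 ≤ #(T.erase a) := pred_card_le_card_erase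
    _ ≤ #((univ.filter fun e : EV m => ∃ t ∈ T, (e : Sym2 (Fin m)) = s(a, t)).image
          fun e : EV m => (e : Sym2 (Fin m))) := by
        refine card_le_card_of_injOn (fun t => s(a, t)) (fun t ht => ?_)
          (fun t _ t' _ h => Sym2.congr_right.1 h)
        rw [mem_coe, mem_erase] at ht
        rw [mem_coe, mem_image]
        exact ⟨⟨s(a, t), hmem t ht.1⟩, mem_filter.2 ⟨mem_univ _, t, ht.2, rfl⟩, rfl⟩
    _ ≤ _ := card_image_le

open Classical in
/-- **Union bound, off-degrees.** Among the negatives of the referee pair, those in which some vertex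
`a` has at least `h` OFF slots `{a, t}` number at most `m · C(m, h) / ⌊m^{1/8}⌋₊^{h-1}` of all
(cross-multiplied): such a negative has a whole star clause of `≥ h - 1` slots inside `M`, and a
fixed clause lies inside `M` for at most a `⌊m^{1/8}⌋₊^{-(h-1)}` fraction of the `M`
(`card_filter_neg_mul_pow_le`). [folklore] -/
theorem card_negFilter_offDegree_mul_le (m h : ℕ) :
    #((((powersetCard (Fintype.card (EV m) / ⌊(m : ℝ) ^ (1 / 8 : ℝ)⌋₊)
        (univ : Finset (EV m))).image (fun M => fun e => decide (e ∉ M))).filter fun y =>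
          ∃ a : Fin m, h ≤ #(univ.filter fun t : Fin m => t ≠ a ∧
            ∃ e : EV m, (e : Sym2 (Fin m)) = s(a, t) ∧ y e = false))) *
        ⌊(m : ℝ) ^ (1 / 8 : ℝ)⌋₊ ^ (h - 1) ≤
      (m * m.choose h) * #(((powersetCard (Fintype.card (EV m) / ⌊(m : ℝ) ^ (1 / 8 : ℝ)⌋₊)
        (univ : Finset (EV m))).image (fun M => fun e => decide (e ∉ M)))) := by
  set D : ℕ := ⌊(m : ℝ) ^ (1 / 8 : ℝ)⌋₊ with hDdef
  set N := ((powersetCard (Fintype.card (EV m) / D) (univ : Finset (EV m))).image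
    (fun M => fun e => decide (e ∉ M))) with hNdef
  rcases Nat.eq_zero_or_pos m with hm0 | hmpos
  · subst hm0
    have h0 : (N.filter fun y => ∃ a : Fin 0, h ≤ #(univ.filter fun t : Fin 0 => t ≠ a ∧
        ∃ e : EV 0, (e : Sym2 (Fin 0)) = s(a, t) ∧ y e = false)) = ∅ :=
      filter_eq_empty_iff.2 fun y _ ⟨a, _⟩ => a.elim0
    rw [h0, card_empty, zero_mul]
    exact Nat.zero_le _
  · have hD : 1 ≤ D := by
      rw [hDdef, Nat.one_le_floor_iff]
      exact Real.one_le_rpow (by exact_mod_cast hmpos) (by norm_num)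
    have htD : Fintype.card (EV m) / D * D ≤ Fintype.card (EV m) := Nat.div_mul_le_self _ _
    set F := (univ : Finset (Fin m)) ×ˢ powersetCard h (univ : Finset (Fin m)) with hFdef
    have hcover := card_mul_le_of_subset_biUnion
      (N.filter fun y => ∃ a : Fin m, h ≤ #(univ.filter fun t : Fin m => t ≠ a ∧
        ∃ e : EV m, (e : Sym2 (Fin m)) = s(a, t) ∧ y e = false))
      F (fun p => N.filter fun y => ¬ SatClause
        (univ.filter fun e : EV m => ∃ t ∈ p.2, (e : Sym2 (Fin m)) = s(p.1, t)) y)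
      (W := D ^ (h - 1)) (total := #N) ?_ ?_
    · refine hcover.trans (Nat.mul_le_mul_right _ (le_of_eq ?_))
      rw [hFdef, card_product, card_univ, Fintype.card_fin, card_powersetCard, card_univ,
        Fintype.card_fin]
    · intro y hy
      rw [mem_filter] at hy
      obtain ⟨hyN, a, ha⟩ := hy
      obtain ⟨T, hTsub, hTcard⟩ := exists_subset_card_eq ha
      rw [mem_biUnion]
      refine ⟨(a, T), ?_, mem_filter.2 ⟨hyN, ?_⟩⟩
      · rw [hFdef, mem_product]
        exact ⟨mem_univ _, mem_powersetCard.2 ⟨subset_univ _, hTcard⟩⟩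
      · rintro ⟨e, he, hye⟩
        rw [mem_filter] at he
        obtain ⟨-, t, htT, het⟩ := he
        have ht := hTsub htT
        rw [mem_filter] at ht
        obtain ⟨-, -, e', he', hye'⟩ := ht
        have hee : e = e' := Subtype.ext (by rw [het, he'])
        rw [hee, hye'] at hye
        exact Bool.false_ne_true hye
    · rintro ⟨a, T⟩ hp
      rw [hFdef, mem_product, mem_powersetCard] at hp
      have hT : #T = h := hp.2.2
      set S := univ.filter fun e : EV m => ∃ t ∈ T, (e : Sym2 (Fin m)) = s(a, t) with hSdef
      have hS : h - 1 ≤ #S := by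
        have := le_card_starClause (m := m) a T
        rw [hT] at this
        exact this
      have hmass := card_filter_neg_mul_pow_le hD htD (fun M => fun e => decide (e ∉ M))
        (fun M e => by simp) S (fun y => ¬ SatClause S y) (fun _ h => h)
      calc #(N.filter fun y => ¬ SatClause S y) * D ^ (h - 1)
          ≤ #(N.filter fun y => ¬ SatClause S y) * D ^ #S :=
            Nat.mul_le_mul_left _ (Nat.pow_le_pow_right hD hS)
        _ ≤ #N := hmass

/-- **Numerics.** Eventually `8 m^{c+1} · m · C(m, m/2 + 1) ≤ ⌊m^{1/8}⌋₊^{m/2}` (`⌊m^{1/8}⌋₊ ≥ 16`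
once `m ≥ 16^8`, `C(m, ·) ≤ 2^m`, and `32 m^{c+2} ≤ 2^m` for large `m`). [folklore] -/
theorem eventually_degree_numerics (c : ℕ) :
    ∀ᶠ m : ℕ in atTop, 8 * m ^ (c + 1) * (m * m.choose (m / 2 + 1)) ≤
      ⌊(m : ℝ) ^ (1 / 8 : ℝ)⌋₊ ^ (m / 2) := by
  obtain ⟨n₀, hn₀⟩ := exists_mul_pow_le_two_pow (c + 2) 32
  filter_upwards [eventually_ge_atTop (max n₀ (16 ^ 8))] with m hm
  have hm₀ : n₀ ≤ m := le_of_max_le_left hm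
  have hm16 : 16 ^ 8 ≤ m := le_of_max_le_right hm
  have hD : 4 ^ 2 ≤ ⌊(m : ℝ) ^ (1 / 8 : ℝ)⌋₊ := by
    by_contra hlt
    rw [not_le] at hlt
    have h1 := lt_floor_rpow_add_one_pow m 8 (e := 1 / 8) (by norm_num)
    have h2 : (⌊(m : ℝ) ^ (1 / 8 : ℝ)⌋₊ + 1) ^ 8 ≤ 16 ^ 8 :=
      Nat.pow_le_pow_left (by omega) 8
    omega
  have h32 : 32 * m ^ (c + 2) ≤ 2 ^ m := hn₀ m hm₀
  have h4 : 4 * (8 * m ^ (c + 1) * (m * m.choose (m / 2 + 1))) ≤ 4 * (4 ^ 2) ^ (m / 2) :=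
    calc 4 * (8 * m ^ (c + 1) * (m * m.choose (m / 2 + 1)))
        ≤ 4 * (8 * m ^ (c + 1) * (m * 2 ^ m)) :=
          Nat.mul_le_mul_left _ (Nat.mul_le_mul_left _
            (Nat.mul_le_mul_left _ (Nat.choose_le_two_pow _ _)))
      _ = 32 * m ^ (c + 2) * 2 ^ m := by ring
      _ ≤ 2 ^ m * 2 ^ m := Nat.mul_le_mul_right _ h32
      _ = 4 ^ m := by rw [← mul_pow]; norm_num
      _ ≤ 4 ^ (2 * (m / 2) + 1) := Nat.pow_le_pow_right (by norm_num) (by omega)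
      _ = 4 * (4 ^ 2) ^ (m / 2) := by rw [pow_succ, pow_mul, mul_comm]
  calc 8 * m ^ (c + 1) * (m * m.choose (m / 2 + 1))
      ≤ (4 ^ 2) ^ (m / 2) := Nat.le_of_mul_le_mul_left h4 (by norm_num)
    _ ≤ ⌊(m : ℝ) ^ (1 / 8 : ℝ)⌋₊ ^ (m / 2) := Nat.pow_le_pow_left hD _

/-- The clique-size bookkeeping: `C(k+1, 2) ≤ m - (m/2 + 1)` for `k = ⌈m^{1/4}⌉₊` and `m ≥ 17`
(`(k-1)^4 < m ≤ k^4`, so `k ≥ 3` and `(k+1)k + 3 ≤ (k-1)^4 < m`). [folklore] -/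
theorem choose_kk_succ_le {m : ℕ} (hm : 17 ≤ m) :
    (⌈(m : ℝ) ^ (1 / 4 : ℝ)⌉₊ + 1).choose 2 ≤ m - (m / 2 + 1) := by
  set k : ℕ := ⌈(m : ℝ) ^ (1 / 4 : ℝ)⌉₊ with hk
  have hm1 : 1 ≤ m := le_trans (by norm_num) hm
  have hk4 : m ≤ k ^ 4 := le_ceil_rpow_pow m 4 (e := 1 / 4) (by norm_num)
  have hk1 : (k - 1) ^ 4 < m := ceil_rpow_sub_one_pow_lt hm1 4 (e := 1 / 4) (by norm_num)
  have hk3 : 3 ≤ k := by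
    by_contra h
    rw [not_le] at h
    have : k ^ 4 ≤ 2 ^ 4 := Nat.pow_le_pow_left (by omega) 4
    omega
  have hpoly : ∀ k' : ℕ, 3 ≤ k' → (k' + 1) * k' + 3 ≤ (k' - 1) ^ 4 := by
    intro k' hk'
    obtain ⟨j, rfl⟩ : ∃ j, k' = j + 1 := ⟨k' - 1, by omega⟩
    have hj : 2 ≤ j := by omega
    rw [Nat.add_sub_cancel]
    have h1 : 4 ≤ j * j := by nlinarith
    calc (j + 1 + 1) * (j + 1) + 3 = j * j + 3 * j + 5 := by ring
      _ ≤ 4 * (j * j) := by nlinarith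
      _ ≤ (j * j) * (j * j) := Nat.mul_le_mul_right _ h1
      _ = j ^ 4 := by ring
  rw [Nat.choose_two_right, Nat.add_sub_cancel]
  have hlt : (k + 1) * k + 3 < m := lt_of_le_of_lt (hpoly k hk3) hk1
  omega

open Classical in
/-- **Row sums of a degree-profile gate.** If row `i` of `B` is induced by non-negative vertex
potentials plus a constant, `B i j = β i + ∑ₐ Λ i a [a ∈ w j]` (`w` the bijective wiring of the
wires onto the edge slots, raw single-slot children `{{w j}}`), then the `i`-th right-hand-side
measurement of an edge vector `u` is `β i · #on(u) + ∑ₐ Λ i a · deg_u(a)`. [folklore] -/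
theorem rowPotential_sum_eq {m n p : ℕ} (w : Fin n ≃ EV m) (β : Fin p → ℝ) (Λ : Fin p → Fin m → ℝ)
    (B : Fin p → Fin n → ℝ)
    (hB : ∀ i j, B i j = β i + ∑ a, Λ i a * (if a ∈ ((w j : EV m) : Sym2 (Fin m)) then (1 : ℝ) else 0))
    (i : Fin p) (u : EV m → Bool) :
    ∑ j, B i j * (if decide (EvalCNF ({{w j}} : Finset (Finset (EV m))) u) then (1 : ℝ) else 0) =
      β i * #(univ.filter fun e : EV m => u e = true) +
        ∑ a, Λ i a * #(univ.filter fun e : EV m => a ∈ (e : Sym2 (Fin m)) ∧ u e = true) := by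
  have h1 : ∀ j, (if decide (EvalCNF ({{w j}} : Finset (Finset (EV m))) u) then (1 : ℝ) else 0) =
      if u (w j) = true then (1 : ℝ) else 0 := fun j => by
    by_cases hu : u (w j) = true <;> simp [evalCNF_singleton_singleton, hu]
  simp_rw [h1, hB]
  rw [Fintype.sum_equiv w _ (fun e : EV m =>
    (β i + ∑ a, Λ i a * (if a ∈ (e : Sym2 (Fin m)) then (1 : ℝ) else 0)) *
      (if u e = true then (1 : ℝ) else 0)) (fun j => rfl)]
  have h2 : ∀ e : EV m, (β i + ∑ a, Λ i a * (if a ∈ (e : Sym2 (Fin m)) then (1 : ℝ) else 0)) *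
      (if u e = true then (1 : ℝ) else 0) =
      β i * (if u e = true then (1 : ℝ) else 0) +
        ∑ a, Λ i a * (if (a ∈ (e : Sym2 (Fin m)) ∧ u e = true) then (1 : ℝ) else 0) := fun e => by
    rw [add_mul, Finset.sum_mul]
    congr 1
    refine Finset.sum_congr rfl fun a _ => ?_
    by_cases ha : a ∈ (e : Sym2 (Fin m)) <;> by_cases hu : u e = true <;> simp [ha, hu]
  simp_rw [h2]
  rw [Finset.sum_add_distrib, ← Finset.mul_sum, Finset.sum_comm, Finset.natCast_card_filter]
  congr 1
  refine Finset.sum_congr rfl fun a _ => ?_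
  rw [← Finset.mul_sum, Finset.natCast_card_filter]

open Classical in
/-- **Degree-profile gates are row-dominated on the referee pair** (the hypothesis of
`convWideCnf_of_rowDominated`, discharged). If every row of `B` is induced by non-negative vertex
potentials plus a non-negative constant (`B i j = β i + ∑ₐ Λ i a [a ∈ w j]`, bijective wiring `w`,
raw single-slot children), then for every `c`, eventually in `m`, all but `≤ #N/(8m^{c+1})` of the
referee negatives `y` dominate every bare `⌈m^{1/4}⌉₊`-clique `x` through the rows of `B`: a
negative all of whose vertices have fewer than `m/2 + 1` OFF slots has every degree
`≥ m - m/2 - 1 ≥ C(k+1, 2) ≥` every degree (and the edge number) of the clique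
(`le_card_filter_on_at`, `card_filter_cliqueVec_le`, `choose_kk_succ_le`), and the other negatives
are few (`card_negFilter_offDegree_mul_le`, `eventually_degree_numerics`). [folklore] -/
theorem degreeProfile_rowDominated : ∀ c : ℕ, ∀ᶠ m : ℕ in atTop, ∀ (n p : ℕ) (w : Fin n ≃ EV m)
    (β : Fin p → ℝ) (Λ : Fin p → Fin m → ℝ) (B : Fin p → Fin n → ℝ),
    (∀ i, 0 ≤ β i) → (∀ i a, 0 ≤ Λ i a) →
    (∀ i j, B i j = β i + ∑ a, Λ i a * (if a ∈ ((w j : EV m) : Sym2 (Fin m)) then (1 : ℝ) else 0)) →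
    (#((((powersetCard (Fintype.card (EV m) / ⌊(m : ℝ) ^ (1 / 8 : ℝ)⌋₊)
        (univ : Finset (EV m))).image (fun M => fun e => decide (e ∉ M)))).filter fun y =>
        ¬ ∀ x ∈ posGraphs m ⌈(m : ℝ) ^ (1 / 4 : ℝ)⌉₊, ∀ i,
          ∑ j, B i j * (if decide (EvalCNF ({{w j}} : Finset (Finset (EV m))) x) then (1 : ℝ) else 0) ≤
            ∑ j, B i j *
              (if decide (EvalCNF ({{w j}} : Finset (Finset (EV m))) y) then (1 : ℝ) else 0)) : ℝ) ≤
      (1 / (8 * (m : ℝ) ^ (c + 1))) *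
        #(((powersetCard (Fintype.card (EV m) / ⌊(m : ℝ) ^ (1 / 8 : ℝ)⌋₊)
          (univ : Finset (EV m))).image (fun M => fun e => decide (e ∉ M)))) := by
  intro c
  filter_upwards [eventually_degree_numerics c, eventually_ge_atTop 17] with m hnum hm n p w β Λ B
    hβ hΛ hB
  set D : ℕ := ⌊(m : ℝ) ^ (1 / 8 : ℝ)⌋₊ with hDdef
  set N := ((powersetCard (Fintype.card (EV m) / D) (univ : Finset (EV m))).image
    (fun M => fun e => decide (e ∉ M))) with hNdef
  set k : ℕ := ⌈(m : ℝ) ^ (1 / 4 : ℝ)⌉₊ with hkdef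
  have hm1 : 1 ≤ m := le_trans (by norm_num) hm
  have hD : 1 ≤ D := by
    rw [hDdef, Nat.one_le_floor_iff]
    exact Real.one_le_rpow (by exact_mod_cast hm1) (by norm_num)
  have hkey : (k + 1).choose 2 ≤ m - (m / 2 + 1) := choose_kk_succ_le hm
  set BAD := N.filter fun y => ∃ a : Fin m, m / 2 + 1 ≤ #(univ.filter fun t : Fin m => t ≠ a ∧
    ∃ e : EV m, (e : Sym2 (Fin m)) = s(a, t) ∧ y e = false) with hBAD
  -- the non-dominating negatives have a vertex with `≥ m/2 + 1` OFF slots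
  have hsub : (N.filter fun y => ¬ ∀ x ∈ posGraphs m k, ∀ i,
      ∑ j, B i j * (if decide (EvalCNF ({{w j}} : Finset (Finset (EV m))) x) then (1 : ℝ) else 0) ≤
        ∑ j, B i j *
          (if decide (EvalCNF ({{w j}} : Finset (Finset (EV m))) y) then (1 : ℝ) else 0)) ⊆ BAD := by
    intro y hy
    rw [mem_filter] at hy
    rw [hBAD, mem_filter]
    refine ⟨hy.1, ?_⟩
    by_contra hgood
    push Not at hgood
    apply hy.2
    intro x hx i
    obtain ⟨Q, hQ, rfl⟩ := mem_image.1 hx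
    have hQk : #Q = k := (mem_powersetCard.1 hQ).2
    rw [rowPotential_sum_eq w β Λ B hB i (cliqueVec Q), rowPotential_sum_eq w β Λ B hB i y]
    have hdegy : ∀ a : Fin m, m - (m / 2 + 1) ≤
        #(univ.filter fun e : EV m => a ∈ (e : Sym2 (Fin m)) ∧ y e = true) := fun a =>
      le_card_filter_on_at y a (hgood a)
    have hallx : #(univ.filter fun e : EV m => cliqueVec Q e = true) ≤ (k + 1).choose 2 :=
      hQk ▸ card_filter_cliqueVec_le Q
    have hdegx : ∀ a : Fin m,
        #(univ.filter fun e : EV m => a ∈ (e : Sym2 (Fin m)) ∧ cliqueVec Q e = true) ≤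
          (k + 1).choose 2 := fun a =>
      le_trans (card_le_card fun e he => by
        rw [mem_filter] at he ⊢
        exact ⟨he.1, he.2.2⟩) hallx
    have hally : m - (m / 2 + 1) ≤ #(univ.filter fun e : EV m => y e = true) :=
      (hdegy ⟨0, hm1⟩).trans (card_le_card fun e he => by
        rw [mem_filter] at he ⊢
        exact ⟨he.1, he.2.2⟩)
    refine add_le_add (mul_le_mul_of_nonneg_left ?_ (hβ i))
      (sum_le_sum fun a _ => mul_le_mul_of_nonneg_left ?_ (hΛ i a))
    · exact_mod_cast hallx.trans (hkey.trans hally)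
    · exact_mod_cast (hdegx a).trans (hkey.trans (hdegy a))
  -- counting
  refine cast_le_eps_mul hm1 ((Nat.mul_le_mul_right _ (card_le_card hsub)).trans ?_)
  have hDpos : 0 < D ^ (m / 2) := pow_pos hD _
  refine Nat.le_of_mul_le_mul_right ?_ hDpos
  have hbad := card_negFilter_offDegree_mul_le m (m / 2 + 1)
  rw [Nat.add_sub_cancel] at hbad
  calc #BAD * (8 * m ^ (c + 1)) * D ^ (m / 2) = #BAD * D ^ (m / 2) * (8 * m ^ (c + 1)) := by ring
    _ ≤ (m * m.choose (m / 2 + 1)) * #N * (8 * m ^ (c + 1)) := Nat.mul_le_mul_right _ hbad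
    _ = 8 * m ^ (c + 1) * (m * m.choose (m / 2 + 1)) * #N := by ring
    _ ≤ D ^ (m / 2) * #N := Nat.mul_le_mul_right _ hnum
    _ = #N * D ^ (m / 2) := by ring

open Classical in
/-- **DEGREE-PROFILE CONV GATES SATISFY THE LEAF `stub_convWideCnf`** (PROPOSED SUB-GOAL, binder-free;
a structural sub-class that is genuinely wide and high-dimensional — any number `p` of rows, any psd
dimension `q`, any real `A, b` — and NOT covered by the few-rows / bounded-dimension / threshold
engines). The class: SDP-feasibility gates `∃ Y ⪰ 0, tr(Aᵢ Y) ≤ bᵢ + (B·x)ᵢ` reading the raw edge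
slots through a bijective wiring `w`, whose switching matrix is induced by non-negative vertex
potentials, `B i j = β i + ∑ₐ Λ i a [a ∈ w j]` — i.e. the gate sees `x` only through
`#edges(x)` and the degree sequence `(deg_x(a))ₐ`, entering with non-negative coefficients: every
"convex test of the degree profile". For every `c`, eventually in `m`, the legal local pair of the
leaf exists at every locality (`degreeProfile_rowDominated` + `convWideCnf_of_rowDominated`): such
a gate accepts no bare clique at all, or it accepts all but `≤ #N/(8m^{c+1})` of the dense
negatives. [folklore] -/
theorem degreeProfileGate_convWideCnf : ∀ c : ℕ, ∀ᶠ m : ℕ in atTop, ∀ (φ : GateFn) (p q : ℕ)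
    (A : Fin p → Matrix (Fin q) (Fin q) ℝ) (b : Fin p → ℝ) (B : Fin p → Fin φ.1 → ℝ)
    (w : Fin φ.1 ≃ (⊤ : SimpleGraph (Fin m)).edgeSet) (β : Fin p → ℝ) (Λ : Fin p → Fin m → ℝ),
    (∀ i, 0 ≤ β i) → (∀ i a, 0 ≤ Λ i a) →
    (∀ i j, B i j = β i + ∑ a, Λ i a *
      (if a ∈ ((w j : (⊤ : SimpleGraph (Fin m)).edgeSet) : Sym2 (Fin m)) then (1 : ℝ) else 0)) →
    (∀ v : Fin φ.1 → Bool, φ.2 v = true ↔ ∃ Y : Matrix (Fin q) (Fin q) ℝ, Y.PosSemidef ∧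
      ∀ i, (A i * Y).trace ≤ b i + ∑ j, B i j * (if v j then (1 : ℝ) else 0)) →
    ∀ r s : ℕ,
        ∃ dnf cnf : Finset (Finset ((⊤ : SimpleGraph (Fin m)).edgeSet)),
          (∀ R ∈ dnf, #R ≤ r - 1) ∧ (∀ S ∈ cnf, #S ≤ s - 1) ∧
          (∀ x, EvalDNF dnf x → EvalCNF cnf x) ∧
          (#((posGraphs m ⌈(m : ℝ) ^ (1 / 4 : ℝ)⌉₊).filter
              (fun x => φ.2 (fun j => decide (EvalCNF
                ({{w j}} : Finset (Finset ((⊤ : SimpleGraph (Fin m)).edgeSet))) x)) = true ∧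
                ¬ EvalDNF dnf x)) : ℝ)
            ≤ (1 / (8 * (m : ℝ) ^ (c + 1))) * #(posGraphs m ⌈(m : ℝ) ^ (1 / 4 : ℝ)⌉₊) ∧
          (#((((powersetCard (Fintype.card ((⊤ : SimpleGraph (Fin m)).edgeSet) / ⌊(m : ℝ) ^ (1 / 8 : ℝ)⌋₊)
          (univ : Finset ((⊤ : SimpleGraph (Fin m)).edgeSet))).image (fun M => fun e => decide (e ∉ M)))).filter
              (fun x => EvalCNF cnf x ∧ φ.2 (fun j => decide (EvalCNF
                ({{w j}} : Finset (Finset ((⊤ : SimpleGraph (Fin m)).edgeSet))) x)) = false)) : ℝ)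
            ≤ (1 / (8 * (m : ℝ) ^ (c + 1))) *
              #(((powersetCard (Fintype.card ((⊤ : SimpleGraph (Fin m)).edgeSet) / ⌊(m : ℝ) ^ (1 / 8 : ℝ)⌋₊)
          (univ : Finset ((⊤ : SimpleGraph (Fin m)).edgeSet))).image (fun M => fun e => decide (e ∉ M)))) := by
  intro c
  filter_upwards [degreeProfile_rowDominated c] with m hm φ p q A b B w β Λ hβ hΛ hB hφ r s
  exact convWideCnf_of_rowDominated c m φ p q A b B hφ (fun j => {{w j}})
    (by convert hm φ.1 p w β Λ B hβ hΛ hB using 4) r s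

end Summit.PneNP.PneNP.Theorems.CliqueExtLowerBound.WidthThreshold.ConvDegreeProfile

end
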